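import Summits.AtomisticToContinuum.Crystallization.Theorems.FrustratedLawDichotomyTwoShellRigidityCells
import Literature.Geometry.DiscreteGeometry.ShellCensusTwelve

/-!
# FrustratedLawDichotomy · two-shell rigidity — the frame assembly REDUCED TO ITS SMALL-ANGLE REGIME, and the triangle covers

`FrameAssemblyAt K c Pat` (lens-5 g30, `FrustratedLawDichotomyTwoShellRigidityCells`) quantifies over ALL bond tolerances
`0 < θ ≤ 1/100`, but the sequential placement that proves it (glue `…TwoShellRigidityPlacement.placement_step`, mirror branch
excluded by a non-contact witness at `0.577·d`) only runs for `θ ≤ θ₁` with `c·θ₁ ≲ 1/117` (hand-1 g10 walk tables: worst step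
factor `46.7·c`).  Above `θ₁` the statement holds TRIVIALLY: every pattern point lies in a link triangle, so a cell fit gives
`‖p z‖ ≤ d + cθd` and the identity fits within `(2 + cθ)·d ≤ ((2 + c/100)/θ₁)·θ·d`.

* `frameAssemblyAt_of_smallAngle` — generic: unit pattern + triangle cover + assembly on `θ ≤ θ₁` with constant `K₁`
  ⟹ `FrameAssemblyAt (max K₁ ((2 + c/100)/θ₁)) c Pat`;
* `fcc_triangleCover`, `hcp_triangleCover` — every point of either kissing pattern lies in a link triangle (integer arithmetic);
* `frameAssemblyAt_fcc_of_smallAngle`, `frameAssemblyAt_hcp_of_smallAngle` — the two instances.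
No `sorry`, no defs.
-/

noncomputable section

namespace Summit.AtomisticToContinuum.Crystallization.Theorems.FrustratedLawDichotomyTwoShellRigidityAssemblyDial

open Literature.Geometry.DiscreteGeometry
open Literature.Geometry.DiscreteGeometry.ShellCensus
open Summit.AtomisticToContinuum.Crystallization.Theorems.FrustratedLawDichotomyTwoShellRigidityCut (E3)
open Summit.AtomisticToContinuum.Crystallization.Theorems.FrustratedLawDichotomyTwoShellRigidityCells

/-- **The frame assembly from its small-angle regime.**  If `Pat` consists of unit vectors each lying in a link triangle, and the
assembly conclusion holds with constant `K₁` for all `0 < θ ≤ θ₁` (`θ ≤ 1/100`), then `FrameAssemblyAt (max K₁ ((2 + c/100)/θ₁)) c Pat`.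
[folklore] -/
theorem frameAssemblyAt_of_smallAngle {K₁ c θ₁ : ℝ} {Pat : Finset E3} (hθ₁ : 0 < θ₁) (hc : 0 ≤ c)
    (hunit : ∀ z ∈ Pat, ‖z‖ = 1)
    (htri : ∀ z : ↥Pat, ∃ u w : ↥Pat, dist (z : E3) (u : E3) = 1 ∧ dist (u : E3) (w : E3) = 1 ∧ dist (z : E3) (w : E3) = 1)
    (hsmall : ∀ (θ d : ℝ), 0 < θ → θ ≤ θ₁ → θ ≤ 1 / 100 → 0 < d → ∀ p : ↥Pat → E3,
      (∀ u w x : ↥Pat, dist (u : E3) (w : E3) = 1 → dist (w : E3) (x : E3) = 1 → dist (u : E3) (x : E3) = 1 →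
          ∃ A : E3 →ₗᵢ[ℝ] E3, ∀ z : ↥Pat, z = u ∨ z = w ∨ z = x → ‖p z - d • A (z : E3)‖ ≤ c * θ * d) →
      (∀ u v w w' : ↥Pat, dist (u : E3) (v : E3) = Real.sqrt 2 → dist (w : E3) (u : E3) = 1 → dist (w : E3) (v : E3) = 1 →
          dist (w' : E3) (u : E3) = 1 → dist (w' : E3) (v : E3) = 1 → dist (w : E3) (w' : E3) = Real.sqrt 2 →
          ∃ A : E3 →ₗᵢ[ℝ] E3, ∀ z : ↥Pat, z = u ∨ z = v ∨ z = w ∨ z = w' → ‖p z - d • A (z : E3)‖ ≤ c * θ * d) →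
      (∀ u v : ↥Pat, u ≠ v → dist (u : E3) (v : E3) ≠ 1 → d ≤ dist (p u) (p v)) →
        ∃ A : E3 →ₗᵢ[ℝ] E3, ∀ z : ↥Pat, ‖p z - d • A (z : E3)‖ ≤ K₁ * θ * d) :
    FrameAssemblyAt (max K₁ ((2 + c / 100) / θ₁)) c Pat := by
  intro θ d hθ0 hθ1 hd p hT hO hN
  have hθd : 0 ≤ θ * d := by positivity
  by_cases hle : θ ≤ θ₁
  · obtain ⟨A, hA⟩ := hsmall θ d hθ0 hle hθ1 hd p hT hO hN
    refine ⟨A, fun z => (hA z).trans ?_⟩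
    have := mul_le_mul_of_nonneg_right (le_max_left K₁ ((2 + c / 100) / θ₁)) hθd
    linarith [this]
  · push Not at hle
    refine ⟨(LinearIsometry.id : E3 →ₗᵢ[ℝ] E3), fun z => ?_⟩
    obtain ⟨u, w, h1, h2, h3⟩ := htri z
    obtain ⟨A', hA'⟩ := hT z u w h1 h2 h3
    have hz := hA' z (Or.inl rfl)
    have hnz : ‖d • A' (z : E3)‖ = d := by
      rw [norm_smul, A'.norm_map, hunit _ z.2, Real.norm_eq_abs, abs_of_pos hd, mul_one]
    have hpz : ‖p z‖ ≤ d + c * θ * d := by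
      have := norm_le_norm_add_norm_sub' (p z) (d • A' (z : E3))
      rw [hnz] at this
      linarith
    have hid : ‖p z - d • (LinearIsometry.id : E3 →ₗᵢ[ℝ] E3) (z : E3)‖ ≤ 2 * d + c * θ * d := by
      refine (norm_sub_le _ _).trans ?_
      rw [LinearIsometry.id_apply, norm_smul, hunit _ z.2, Real.norm_eq_abs, abs_of_pos hd, mul_one]
      linarith
    refine hid.trans ?_
    have h1' : c * θ ≤ c / 100 := by nlinarith [hc, hθ1]
    have h2' : (2 + c / 100) * θ₁ ≤ (2 + c / 100) * θ := mul_le_mul_of_nonneg_left hle.le (by positivity)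
    have h3' : 2 + c / 100 ≤ (2 + c / 100) / θ₁ * θ := by
      rw [div_mul_eq_mul_div, le_div_iff₀ hθ₁]
      exact h2'
    have h4' : (2 + c / 100) / θ₁ * θ * d ≤ max K₁ ((2 + c / 100) / θ₁) * θ * d :=
      mul_le_mul_of_nonneg_right (mul_le_mul_of_nonneg_right (le_max_right _ _) hθ0.le) hd.le
    nlinarith [h1', h3', h4', hd]

/-! ## Triangle covers of the two kissing patterns (integer arithmetic) -/

/-- `fccTuple k ∈ fccKissingPattern`. [folklore] -/
theorem fccTuple_mem (k : Fin 12) : fccTuple k ∈ fccKissingPattern := by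
  rw [← image_fccTuple]; exact Finset.mem_image_of_mem _ (Finset.mem_univ _)

/-- `hcpTuple k ∈ hcpKissingPattern`. [folklore] -/
theorem hcpTuple_mem (k : Fin 12) : hcpTuple k ∈ hcpKissingPattern := by
  rw [← image_hcpTuple]; exact Finset.mem_image_of_mem _ (Finset.mem_univ _)

/-- Every point of the fcc pattern is some `fccTuple k`. [folklore] -/
theorem exists_fccTuple_eq {z : E3} (hz : z ∈ fccKissingPattern) : ∃ k : Fin 12, fccTuple k = z := by
  rw [← image_fccTuple] at hz
  obtain ⟨k, -, hk⟩ := Finset.mem_image.1 hz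
  exact ⟨k, hk⟩

/-- Every point of the hcp pattern is some `hcpTuple k`. [folklore] -/
theorem exists_hcpTuple_eq {z : E3} (hz : z ∈ hcpKissingPattern) : ∃ k : Fin 12, hcpTuple k = z := by
  rw [← image_hcpTuple] at hz
  obtain ⟨k, -, hk⟩ := Finset.mem_image.1 hz
  exact ⟨k, hk⟩

/-- Distances in the hcp tuple: `dist = (√18)⁻¹ · √(sqNormInt (vⱼ − v_k))`. [folklore] -/
theorem dist_hcpTuple (j k : Fin 12) :
    dist (hcpTuple j) (hcpTuple k) = (Real.sqrt 18)⁻¹ * Real.sqrt (sqNormInt (hcpVec j - hcpVec k) : ℝ) := by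
  rw [hcpTuple, hcpTuple, dist_eq_norm, ← smul_sub, intVec_sub, norm_smul, norm_inv, norm_intVec,
    Nat.cast_ofNat, Real.norm_of_nonneg (Real.sqrt_nonneg _)]

/-- A bond of the fcc tuple from the integer model. [folklore] -/
theorem dist_fccTuple_eq_one {j k : Fin 12} (h : sqNormInt (fccVec j - fccVec k) = 2) : dist (fccTuple j) (fccTuple k) = 1 := by
  rw [dist_fccTuple, h]
  push_cast
  exact inv_mul_cancel₀ (by positivity)

/-- A bond of the hcp tuple from the integer model. [folklore] -/
theorem dist_hcpTuple_eq_one {j k : Fin 12} (h : sqNormInt (hcpVec j - hcpVec k) = 18) :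
    dist (hcpTuple j) (hcpTuple k) = 1 := by
  rw [dist_hcpTuple, h]
  push_cast
  exact inv_mul_cancel₀ (by positivity)

/-- Integer triangle cover of the fcc model. [folklore] -/
theorem fccVec_triangleCover : ∀ k : Fin 12, ∃ a b : Fin 12,
    sqNormInt (fccVec k - fccVec a) = 2 ∧ sqNormInt (fccVec a - fccVec b) = 2 ∧ sqNormInt (fccVec k - fccVec b) = 2 := by
  decide

/-- Integer triangle cover of the hcp model. [folklore] -/
theorem hcpVec_triangleCover : ∀ k : Fin 12, ∃ a b : Fin 12,
    sqNormInt (hcpVec k - hcpVec a) = 18 ∧ sqNormInt (hcpVec a - hcpVec b) = 18 ∧ sqNormInt (hcpVec k - hcpVec b) = 18 := by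
  decide

/-- **Every point of the fcc kissing pattern lies in a link triangle.** [folklore] -/
theorem fcc_triangleCover : ∀ z : ↥fccKissingPattern, ∃ u w : ↥fccKissingPattern,
    dist (z : E3) (u : E3) = 1 ∧ dist (u : E3) (w : E3) = 1 ∧ dist (z : E3) (w : E3) = 1 := by
  intro z
  obtain ⟨k, hk⟩ := exists_fccTuple_eq z.2
  obtain ⟨a, b, h1, h2, h3⟩ := fccVec_triangleCover k
  refine ⟨⟨fccTuple a, fccTuple_mem a⟩, ⟨fccTuple b, fccTuple_mem b⟩, ?_, dist_fccTuple_eq_one h2, ?_⟩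
  · rw [← hk]; exact dist_fccTuple_eq_one h1
  · rw [← hk]; exact dist_fccTuple_eq_one h3

/-- **Every point of the hcp kissing pattern lies in a link triangle.** [folklore] -/
theorem hcp_triangleCover : ∀ z : ↥hcpKissingPattern, ∃ u w : ↥hcpKissingPattern,
    dist (z : E3) (u : E3) = 1 ∧ dist (u : E3) (w : E3) = 1 ∧ dist (z : E3) (w : E3) = 1 := by
  intro z
  obtain ⟨k, hk⟩ := exists_hcpTuple_eq z.2
  obtain ⟨a, b, h1, h2, h3⟩ := hcpVec_triangleCover k
  refine ⟨⟨hcpTuple a, hcpTuple_mem a⟩, ⟨hcpTuple b, hcpTuple_mem b⟩, ?_, dist_hcpTuple_eq_one h2, ?_⟩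
  · rw [← hk]; exact dist_hcpTuple_eq_one h1
  · rw [← hk]; exact dist_hcpTuple_eq_one h3

/-- **fcc: the frame assembly from its small-angle regime.** [folklore] -/
theorem frameAssemblyAt_fcc_of_smallAngle {K₁ c θ₁ : ℝ} (hθ₁ : 0 < θ₁) (hc : 0 ≤ c)
    (hsmall : ∀ (θ d : ℝ), 0 < θ → θ ≤ θ₁ → θ ≤ 1 / 100 → 0 < d → ∀ p : ↥fccKissingPattern → E3,
      (∀ u w x : ↥fccKissingPattern, dist (u : E3) (w : E3) = 1 → dist (w : E3) (x : E3) = 1 → dist (u : E3) (x : E3) = 1 →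
          ∃ A : E3 →ₗᵢ[ℝ] E3, ∀ z : ↥fccKissingPattern, z = u ∨ z = w ∨ z = x → ‖p z - d • A (z : E3)‖ ≤ c * θ * d) →
      (∀ u v w w' : ↥fccKissingPattern, dist (u : E3) (v : E3) = Real.sqrt 2 → dist (w : E3) (u : E3) = 1 →
          dist (w : E3) (v : E3) = 1 → dist (w' : E3) (u : E3) = 1 → dist (w' : E3) (v : E3) = 1 →
          dist (w : E3) (w' : E3) = Real.sqrt 2 →
          ∃ A : E3 →ₗᵢ[ℝ] E3, ∀ z : ↥fccKissingPattern, z = u ∨ z = v ∨ z = w ∨ z = w' → ‖p z - d • A (z : E3)‖ ≤ c * θ * d) →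
      (∀ u v : ↥fccKissingPattern, u ≠ v → dist (u : E3) (v : E3) ≠ 1 → d ≤ dist (p u) (p v)) →
        ∃ A : E3 →ₗᵢ[ℝ] E3, ∀ z : ↥fccKissingPattern, ‖p z - d • A (z : E3)‖ ≤ K₁ * θ * d) :
    FrameAssemblyAt (max K₁ ((2 + c / 100) / θ₁)) c fccKissingPattern :=
  frameAssemblyAt_of_smallAngle hθ₁ hc (fun _ hz => norm_eq_one_of_mem_fccKissingPattern hz) fcc_triangleCover hsmall

/-- **hcp: the frame assembly from its small-angle regime.** [folklore] -/
theorem frameAssemblyAt_hcp_of_smallAngle {K₁ c θ₁ : ℝ} (hθ₁ : 0 < θ₁) (hc : 0 ≤ c)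
    (hsmall : ∀ (θ d : ℝ), 0 < θ → θ ≤ θ₁ → θ ≤ 1 / 100 → 0 < d → ∀ p : ↥hcpKissingPattern → E3,
      (∀ u w x : ↥hcpKissingPattern, dist (u : E3) (w : E3) = 1 → dist (w : E3) (x : E3) = 1 → dist (u : E3) (x : E3) = 1 →
          ∃ A : E3 →ₗᵢ[ℝ] E3, ∀ z : ↥hcpKissingPattern, z = u ∨ z = w ∨ z = x → ‖p z - d • A (z : E3)‖ ≤ c * θ * d) →
      (∀ u v w w' : ↥hcpKissingPattern, dist (u : E3) (v : E3) = Real.sqrt 2 → dist (w : E3) (u : E3) = 1 →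
          dist (w : E3) (v : E3) = 1 → dist (w' : E3) (u : E3) = 1 → dist (w' : E3) (v : E3) = 1 →
          dist (w : E3) (w' : E3) = Real.sqrt 2 →
          ∃ A : E3 →ₗᵢ[ℝ] E3, ∀ z : ↥hcpKissingPattern, z = u ∨ z = v ∨ z = w ∨ z = w' → ‖p z - d • A (z : E3)‖ ≤ c * θ * d) →
      (∀ u v : ↥hcpKissingPattern, u ≠ v → dist (u : E3) (v : E3) ≠ 1 → d ≤ dist (p u) (p v)) →
        ∃ A : E3 →ₗᵢ[ℝ] E3, ∀ z : ↥hcpKissingPattern, ‖p z - d • A (z : E3)‖ ≤ K₁ * θ * d) :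
    FrameAssemblyAt (max K₁ ((2 + c / 100) / θ₁)) c hcpKissingPattern :=
  frameAssemblyAt_of_smallAngle hθ₁ hc (fun _ hz => norm_eq_one_of_mem_hcpKissingPattern hz) hcp_triangleCover hsmall

end Summit.AtomisticToContinuum.Crystallization.Theorems.FrustratedLawDichotomyTwoShellRigidityAssemblyDial

end
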